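import Summits.ABC.ABC.Theorems.CongruentialReceptacleTameLocalReceptacleDefs
import Literature.NumberTheory.Sieve.TwistedCharacterSmoothSum
import Literature.NumberTheory.Sieve.SmoothSaddlePoint

/-!
# Crux `CongruentialReceptacle.TameLocalReceptacle` (stmt-ABC-14354): objects of the line
`grh-friable-cell-resolution`

Definitions used by the checked skeleton `Cruxes/TameLocalReceptacle/Lines/grh_friable_cell_resolution.lean`
(planner-cruxplan-stmt-ABC-14354-grh-friable-cell-res-0, 2026-08-17; lead `prover-line-stmt-ABC-14354-a1-0`) and by the
`--supports` files of its registered stubs.  The line derives the matching hypothesis `MatchingFamilies (1/4)` of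
`CongruentialReceptacleTameLocalReceptacleDefs.lean` (which refutes the crux, `TameLocalReceptacle_false_of_MatchingHypothesis`)
from the Generalized Riemann Hypothesis, in the Lagarias–Soundararajan polylog regime `y = (log X)^K`.  Statements are
VERBATIM those of the registered skeleton; they are moved here per CONVENTIONS §6 (route-posited objects live in a reviewed
Defs file, never in a proof file).  This is a separate file from `…TameLocalReceptacleDefs.lean` only because of the
400-line bound (one topic: the key-cell vocabulary of this line).

* Analytic currencies (plain `Prop`s, to be PROVED by the line's stubs — the first under GRH — not named literature facts):
  `SmoothLLindelof` (Lindelöf-on-`Re s ≥ 1/2+ε` for the partial Euler products `L(s, χ; y)` = the tree's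
  `TwistedWeight.smoothLC`; under GRH this is Lagarias–Soundararajan, PLMS 104 (2012), Prop. 5.1),
  `FriableCharSumBound` (power saving for character-twisted friable sums with the tree's weight `TwistedWeight.twistWeight`),
  `SmoothLocalBehaviour` (local behaviour `Ψ(x/t, y) ∼ t^{−α(x,y)} Ψ(x, y)`, `t ≤ y^C`, in the polylog regime; a corollary of
  Hildebrand–Tenenbaum, Trans. AMS 296 (1986), Thm 3, with `α = saddlePoint x y` of the tree).
* Key-cell vocabulary over the Defs objects `mean`, `datum`, `IsBalanced`: `Pos` (member positions) with `Pos.sel`,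
  `Pos.exps`, `Pos.adm`; `mkDatum`, `keyWeight`, `intensity`, `cellMass`, `oddPrimesBelow`, `classDiscrepancy`,
  `valuationDiscrepancy`, and the line's analytic target `KeyCellStructure κ` (strictly finer than `MatchingFamilies κ`).

Deliberately NOT here: the stubs, the composition, and the line target `¬ TameLocalReceptacle` (they stay in the skeleton /
the stub files); no witness families are fixed (the statements leave the design free).
-/

-- `Summit.<Summit>.<Problem>` is the mandated summit-side namespace (CONVENTIONS §2); for the
-- single-conjunct summit `ABC` the two coincide, so the duplicate `ABC.ABC` is deliberate.
set_option linter.dupNamespace false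

noncomputable section

namespace Summit.ABC.ABC.Theorems.TameLocalReceptacle

open Finset
open Literature.NumberTheory.Sieve
open Literature.NumberTheory.Sieve.TwistedWeight

/-! ## Analytic currencies -/

/-- **Lindelöf-type bound for the partial Euler products on `Re s ≥ 1/2 + ε`**: for every `ε > 0` there is `C > 0` with
`‖L(s, χ; y)‖ ≤ C (q(1 + |Im s|))^ε` for all moduli `q ≠ 0`, all NON-PRINCIPAL characters `χ` mod `q`, all `y`, and all `s`
with `Re s ≥ 1/2 + ε`, where `L(s, χ; y) = ∏_{p ≤ y} (1 − χ(p)p^{−s})⁻¹` is `TwistedWeight.smoothLC χ s y`.  Under GRH this is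
Lagarias–Soundararajan 2012, Prop. 5.1 (imprimitive factor `≤ 2^{ω(q)}` absorbed); it is the conclusion of the line's stub
`stub_smoothLLindelof_of_grh : GeneralizedRiemannHypothesis → SmoothLLindelof`. -/
def SmoothLLindelof : Prop :=
  ∀ ε : ℝ, 0 < ε → ∃ C : ℝ, 0 < C ∧ ∀ (q : ℕ) (χ : DirichletCharacter ℂ q), q ≠ 0 → χ ≠ 1 →
    ∀ (y : ℕ) (s : ℂ), 1 / 2 + ε ≤ s.re → ‖smoothLC χ s y‖ ≤ C * ((q : ℝ) * (1 + |s.im|)) ^ ε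

/-- **Power-saving bound for character-twisted, smooth-weighted friable sums** (the currency the circle method consumes),
for the tree's weight `W_λ(v) = v²(1−v)² e(λv)` (`TwistedWeight.twistWeight`): for every `ε > 0` there is `C > 0` with
`‖∑_{n ∈ S(X, y)} χ(n) W_λ(n/X)‖ ≤ C (1 + |λ|)³ X^{1/2+ε} q^ε` for all `q ≠ 0`, all non-principal `χ` mod `q`, all `y`, all
real `X ≥ 1` and all real `λ`.  Conclusion of the stub `stub_friableCharSums_of_lindelof : SmoothLLindelof → FriableCharSumBound`
(the Mellin identity `TwistedWeight.sum_char_twistWeight_eq_integral` read on `Re s = 1/2 + ε`). -/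
def FriableCharSumBound : Prop :=
  ∀ ε : ℝ, 0 < ε → ∃ C : ℝ, 0 < C ∧ ∀ (q : ℕ) (χ : DirichletCharacter ℂ q), q ≠ 0 → χ ≠ 1 →
    ∀ (y : ℕ) (X lam : ℝ), 1 ≤ X →
      ‖∑ n ∈ Nat.smoothNumbersUpTo ⌊X⌋₊ (y + 1), χ (n : ZMod q) * twistWeight lam (n / X)‖ ≤
        C * (1 + |lam|) ^ 3 * X ^ (1 / 2 + ε) * (q : ℝ) ^ ε

/-- **Local behaviour of `Ψ(x, y)` in the polylog regime**: for fixed `K, C` and `ε > 0`, for all large `x`, all `y` with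
`log x ≤ y ≤ (log x)^K` and all real `1 ≤ t ≤ y^C`,
`|Ψ(x/t, y) − t^{−α(x,y)} Ψ(x, y)| ≤ ε t^{−α(x,y)} Ψ(x, y)`, with `α = saddlePoint x y` and
`Ψ(z, y) = #(Nat.smoothNumbersUpTo ⌊z⌋₊ (y+1))` as in the tree's `Smooth*` files.  A corollary of Hildebrand–Tenenbaum 1986,
Thm 3 (`Ψ(cx, y) = Ψ(x, y) c^{α(x,y)} (1 + O(1/u + log y/y))`, `1 ≤ c ≤ y`), iterated and combined with the saddle-point
perturbation `t^{α(x/t,y) − α(x,y)} = 1 + o(1)`; conclusion of the stub `stub_smoothLocalBehaviour`.  UNCONDITIONAL. -/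
def SmoothLocalBehaviour : Prop :=
  ∀ (K C : ℕ) (ε : ℝ), 0 < ε → ∃ x₀ : ℝ, ∀ x : ℝ, x₀ ≤ x → ∀ y : ℕ,
    Real.log x ≤ (y : ℝ) → (y : ℝ) ≤ Real.log x ^ K → ∀ t : ℝ, 1 ≤ t → t ≤ (y : ℝ) ^ C →
      |((Nat.smoothNumbersUpTo ⌊x / t⌋₊ (y + 1)).card : ℝ) -
          t ^ (-(saddlePoint x y)) * ((Nat.smoothNumbersUpTo ⌊x⌋₊ (y + 1)).card : ℝ)| ≤
        ε * (t ^ (-(saddlePoint x y)) * ((Nat.smoothNumbersUpTo ⌊x⌋₊ (y + 1)).card : ℝ))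

/-! ## Key-cell vocabulary (over the Defs objects `mean`, `datum`, `IsBalanced`, `MatchingFamilies`) -/

/-- The three member positions of a triple `(a, b, c)`. -/
inductive Pos
  | A
  | B
  | C
  deriving DecidableEq

namespace Pos

/-- The member in position `P`. -/
def sel : Pos → ℕ × ℕ × ℕ → ℕ
  | A, T => T.1
  | B, T => T.2.1
  | C, T => T.2.2

/-- The exponent triple `(v_q a, v_q b, v_q c)` of a key of valuation `v` in position `P` (on an abc-triple the two other
valuations vanish by coprimality). -/
def exps : Pos → ℕ → ℕ × ℕ × ℕ
  | A, v => (v, 0, 0)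
  | B, v => (0, v, 0)
  | C, v => (0, 0, v)

/-- ADMISSIBLE residue classes `(r, s, z) = (a′ mod q, b′ mod q, c′ mod q)` of a key at an odd prime `q` in position `P` on
an abc-triple: the member's unit residue is a unit, the two partners are units tied by `a + b = c` — position `A` (`q ∣ a`):
`z = s`; position `B`: `z = r`; position `C` (`q ∣ c`): `s ≡ −r`, i.e. `s = q − r`.  Each admissible set has `(q − 1)²`
elements. -/
def adm : Pos → ℕ → ℕ → ℕ → ℕ → Bool
  | A, _, r, s, z => decide (0 < r ∧ 0 < s ∧ z = s)
  | B, _, r, s, z => decide (0 < r ∧ 0 < s ∧ z = r)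
  | C, q, r, s, z => decide (0 < r ∧ 0 < z ∧ s = q - r)

end Pos

/-- Assemble a datum from an exponent triple and three residues. -/
def mkDatum (e : ℕ × ℕ × ℕ) (r s z : ℕ) : ℕ × ℕ × ℕ × ℕ × ℕ × ℕ :=
  (e.1, e.2.1, e.2.2, r, s, z)

/-- The window weight of a key with exponents `e = (i, j, k)` at `q`: `((i+j+k) + 1) · log q` — the bound of
`WindowBounded`. -/
def keyWeight (e : ℕ × ℕ × ℕ) (q : ℕ) : ℝ :=
  (((e.1 + e.2.1 + e.2.2 : ℕ) : ℝ) + 1) * Real.log q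

/-- KEY INTENSITY: the family mean of the event "`q` divides the member in position `P` and the tame datum at `q` is `D`"
— the position-`P` key-intensity measure of `F` evaluated at the key `(q; D)`. -/
def intensity (F : Finset (ℕ × ℕ × ℕ)) (P : Pos) (q : ℕ) (D : ℕ × ℕ × ℕ × ℕ × ℕ × ℕ) : ℝ :=
  mean F (fun T => if q ∈ (P.sel T).primeFactors ∧ datum T.1 T.2.1 T.2.2 q = D then 1 else 0)

/-- VALUATION-CELL MASS: total intensity of the keys at `q` in position `P` with valuation `v` (summed over all residue
classes). -/
def cellMass (F : Finset (ℕ × ℕ × ℕ)) (P : Pos) (q v : ℕ) : ℝ :=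
  ∑ r ∈ range q, ∑ s ∈ range q, ∑ z ∈ range q, intensity F P q (mkDatum (P.exps v) r s z)

/-- The odd primes below `Q`. -/
def oddPrimesBelow (Q : ℕ) : Finset ℕ :=
  (range Q).filter (fun q => q.Prime ∧ q ≠ 2)

/-- CLASS DISCREPANCY of `F` in position `P` (truncated at primes `< Q`, valuations `≤ V`): the weighted `L¹` distance
between the key-intensity measure and its CLASS-UNIFORM model (mass `cellMass/(q−1)²` on each admissible class, `0` on
inadmissible ones). -/
def classDiscrepancy (F : Finset (ℕ × ℕ × ℕ)) (P : Pos) (Q V : ℕ) : ℝ :=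
  ∑ q ∈ oddPrimesBelow Q, ∑ v ∈ Icc 1 V, ∑ r ∈ range q, ∑ s ∈ range q, ∑ z ∈ range q,
    keyWeight (P.exps v) q *
      |intensity F P q (mkDatum (P.exps v) r s z) -
        (if P.adm q r s z then cellMass F P q v / (((q : ℝ) - 1) ^ 2) else 0)|

/-- VALUATION DISCREPANCY between `F` and `G` in position `P`: the weighted `L¹` distance between the two valuation laws
`v ↦ cellMass · P q v` over odd primes `q < Q`, `1 ≤ v ≤ V`. -/
def valuationDiscrepancy (F G : Finset (ℕ × ℕ × ℕ)) (P : Pos) (Q V : ℕ) : ℝ :=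
  ∑ q ∈ oddPrimesBelow Q, ∑ v ∈ Icc 1 V, keyWeight (P.exps v) q * |cellMass F P q v - cellMass G P q v|

/-- **KEY-CELL STRUCTURE at balance `κ`** — the analytic target of the line, strictly finer than `MatchingFamilies κ`
(which it implies by the stub `stub_matchingFamilies_of_keyCells`): the same five families and shape clauses as
`MatchingFamilies κ`, and, for every truncation `(Q, V)`,
(CE) each of the fifteen (family, position) key-intensity measures is within `δ·N` of its class-uniform model,
(VM) the nine valuation laws paired as in `MatchingFamilies` (`FA.A ≈ G'.A`, `FA.B ≈ G.B`, …, `FC.C ≈ G'.C`) are within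
`δ·N`.  Intended witnesses (one convenient choice; the statement leaves the design free): `y = ⌊(log X)^K⌋`,
`N = ⌊θ log₂ X⌋`, `FA = {(2^N m, b, 2^N m + b)}` with `m ∈ S(y) ∩ (X/2^N, 2X/2^N]` odd and `b, 2^N m + b ∈ S(y)`,
`b ∈ (X, 2X]` (balance `1/4` is automatic), `FB` symmetric, `FC = {(a, 2^N m − a, 2^N m)}` with `a ∈ (X, 3X/2]`,
`2^N m ∈ (2X, 4X]`; `G` = the same shape with `N` replaced by `1`, `G'` = `G` at the scale `X/2^N`; all filtered to
abc-triples; `K` large, `θ` small, `X ≥ X₀(K, θ, δ)`. -/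
def KeyCellStructure (κ : ℝ) : Prop :=
  ∃ V₀ : ℕ, ∀ δ : ℝ, 0 < δ → ∀ N₁ : ℕ, ∃ N : ℕ, N₁ ≤ N ∧
    ∃ FA FB FC G G' : Finset (ℕ × ℕ × ℕ),
      FA.Nonempty ∧ FB.Nonempty ∧ FC.Nonempty ∧ G.Nonempty ∧ G'.Nonempty ∧
      (∀ T ∈ FA, IsBalanced κ T.1 T.2.1 T.2.2 ∧ T.1.factorization 2 = N) ∧
      (∀ T ∈ FB, IsBalanced κ T.1 T.2.1 T.2.2 ∧ T.2.1.factorization 2 = N) ∧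
      (∀ T ∈ FC, IsBalanced κ T.1 T.2.1 T.2.2 ∧ T.2.2.factorization 2 = N) ∧
      (∀ T ∈ G, IsBalanced κ T.1 T.2.1 T.2.2 ∧ (T.1 * T.2.1 * T.2.2).factorization 2 ≤ V₀) ∧
      (∀ T ∈ G', IsBalanced κ T.1 T.2.1 T.2.2 ∧ (T.1 * T.2.1 * T.2.2).factorization 2 ≤ V₀) ∧
      (∀ (P : Pos) (Q V : ℕ),
        classDiscrepancy FA P Q V ≤ δ * N ∧ classDiscrepancy FB P Q V ≤ δ * N ∧
        classDiscrepancy FC P Q V ≤ δ * N ∧ classDiscrepancy G P Q V ≤ δ * N ∧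
        classDiscrepancy G' P Q V ≤ δ * N) ∧
      (∀ Q V : ℕ,
        valuationDiscrepancy FA G' Pos.A Q V ≤ δ * N ∧ valuationDiscrepancy FA G Pos.B Q V ≤ δ * N ∧
        valuationDiscrepancy FA G Pos.C Q V ≤ δ * N ∧ valuationDiscrepancy FB G Pos.A Q V ≤ δ * N ∧
        valuationDiscrepancy FB G' Pos.B Q V ≤ δ * N ∧ valuationDiscrepancy FB G Pos.C Q V ≤ δ * N ∧
        valuationDiscrepancy FC G Pos.A Q V ≤ δ * N ∧ valuationDiscrepancy FC G Pos.B Q V ≤ δ * N ∧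
        valuationDiscrepancy FC G' Pos.C Q V ≤ δ * N)

/-! ## The mass of the class-uniform model (registered stub `stub_admMass` of the checked skeleton) -/

/-- `#{r < q : 0 < r} = q − 1` as a real sum of indicators. [folklore] -/
theorem sum_range_ite_pos (q : ℕ) (h : 1 ≤ q) :
    ∑ r ∈ range q, (if 0 < r then (1 : ℝ) else 0) = (q : ℝ) - 1 := by
  rw [Finset.sum_boole]
  have hset : (range q).filter (fun r => 0 < r) = (range q).erase 0 := by
    ext r
    simp only [Finset.mem_filter, Finset.mem_range, Finset.mem_erase, Nat.pos_iff_ne_zero]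
    tauto
  rw [hset, Finset.card_erase_of_mem (Finset.mem_range.2 (by omega)), Finset.card_range, Nat.cast_sub h]
  simp

/-- **Registered stub `stub_admMass`** (line `grh-friable-cell-resolution` of crux stmt-ABC-14354): the class-uniform
model has total mass `(q−1)²` per unit — for every position `P` and every `q ≥ 1`, exactly `(q − 1)²` of the `q³`
residue triples `(r, s, z) ∈ (range q)³` are admissible.  Used by `stub_matchingFamilies_of_keyCells` (middle term of the
triangle inequality, `|∑_{adm} w| ≤ (q−1)² · keyWeight`) and by `stub_keyCellStructure` (normalisation of the
class-uniform main term). [folklore] -/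
theorem stub_admMass : ∀ (P : Pos) (q : ℕ), 1 ≤ q →
    ∑ r ∈ range q, ∑ s ∈ range q, ∑ z ∈ range q, (if P.adm q r s z then (1 : ℝ) else 0) = ((q : ℝ) - 1) ^ 2 := by
  intro P q hq
  have hone := sum_range_ite_pos q hq
  -- the `z`-sum of the indicator of `z = s` over `range q` is `1` when `s < q`
  have hz : ∀ s ∈ range q, ∑ z ∈ range q, (if z = s then (1 : ℝ) else 0) = 1 := by
    intro s hs
    rw [Finset.sum_ite_eq' (range q) s (fun _ => (1 : ℝ))]
    rw [if_pos hs]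
  cases P with
  | A =>
    -- `adm A _ r s z ↔ 0 < r ∧ 0 < s ∧ z = s`
    have hinner : ∀ r ∈ range q, ∑ s ∈ range q, ∑ z ∈ range q,
        (if Pos.adm Pos.A q r s z then (1 : ℝ) else 0) =
          (if 0 < r then (1 : ℝ) else 0) * ((q : ℝ) - 1) := by
      intro r _
      by_cases hr : 0 < r
      · rw [if_pos hr, one_mul, ← hone]
        refine Finset.sum_congr rfl fun s hs => ?_
        by_cases hs0 : 0 < s
        · rw [if_pos hs0]
          calc ∑ z ∈ range q, (if Pos.adm Pos.A q r s z then (1 : ℝ) else 0)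
              = ∑ z ∈ range q, (if z = s then (1 : ℝ) else 0) :=
                Finset.sum_congr rfl fun z _ => by
                  by_cases hzs : z = s
                  · simp [Pos.adm, hr, hs0, hzs]
                  · simp [Pos.adm, hzs]
            _ = 1 := hz s hs
        · rw [if_neg hs0]
          refine Finset.sum_eq_zero fun z _ => ?_
          simp [Pos.adm, hs0]
      · rw [if_neg hr, zero_mul]
        refine Finset.sum_eq_zero fun s _ => Finset.sum_eq_zero fun z _ => ?_
        simp [Pos.adm, hr]
    rw [Finset.sum_congr rfl hinner, ← Finset.sum_mul, hone]
    ring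
  | B =>
    -- `adm B _ r s z ↔ 0 < r ∧ 0 < s ∧ z = r`
    have hinner : ∀ r ∈ range q, ∑ s ∈ range q, ∑ z ∈ range q,
        (if Pos.adm Pos.B q r s z then (1 : ℝ) else 0) =
          (if 0 < r then (1 : ℝ) else 0) * ((q : ℝ) - 1) := by
      intro r hr'
      by_cases hr : 0 < r
      · rw [if_pos hr, one_mul, ← hone]
        refine Finset.sum_congr rfl fun s _ => ?_
        by_cases hs0 : 0 < s
        · rw [if_pos hs0]
          calc ∑ z ∈ range q, (if Pos.adm Pos.B q r s z then (1 : ℝ) else 0)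
              = ∑ z ∈ range q, (if z = r then (1 : ℝ) else 0) :=
                Finset.sum_congr rfl fun z _ => by
                  by_cases hzr : z = r
                  · simp [Pos.adm, hr, hs0, hzr]
                  · simp [Pos.adm, hzr]
            _ = 1 := hz r hr'
        · rw [if_neg hs0]
          refine Finset.sum_eq_zero fun z _ => ?_
          simp [Pos.adm, hs0]
      · rw [if_neg hr, zero_mul]
        refine Finset.sum_eq_zero fun s _ => Finset.sum_eq_zero fun z _ => ?_
        simp [Pos.adm, hr]
    rw [Finset.sum_congr rfl hinner, ← Finset.sum_mul, hone]
    ring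
  | C =>
    -- `adm C q r s z ↔ 0 < r ∧ 0 < z ∧ s = q - r`; for `0 < r < q`, `q - r ∈ range q`
    have hinner : ∀ r ∈ range q, ∑ s ∈ range q, ∑ z ∈ range q,
        (if Pos.adm Pos.C q r s z then (1 : ℝ) else 0) =
          (if 0 < r then (1 : ℝ) else 0) * ((q : ℝ) - 1) := by
      intro r hr'
      have hrq : r < q := Finset.mem_range.1 hr'
      by_cases hr : 0 < r
      · rw [if_pos hr, one_mul]
        -- swap the `s`- and `z`-sums
        rw [Finset.sum_comm]
        rw [← hone]
        refine Finset.sum_congr rfl fun z _ => ?_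
        by_cases hz0 : 0 < z
        · rw [if_pos hz0]
          have hmem : q - r ∈ range q := Finset.mem_range.2 (by omega)
          calc ∑ s ∈ range q, (if Pos.adm Pos.C q r s z then (1 : ℝ) else 0)
              = ∑ s ∈ range q, (if s = q - r then (1 : ℝ) else 0) :=
                Finset.sum_congr rfl fun s _ => by
                  by_cases hsq : s = q - r
                  · simp [Pos.adm, hr, hz0, hsq]
                  · simp [Pos.adm, hsq]
            _ = 1 := hz (q - r) hmem
        · rw [if_neg hz0]
          refine Finset.sum_eq_zero fun s _ => ?_
          simp [Pos.adm, hz0]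
      · rw [if_neg hr, zero_mul]
        refine Finset.sum_eq_zero fun s _ => Finset.sum_eq_zero fun z _ => ?_
        simp [Pos.adm, hr]
    rw [Finset.sum_congr rfl hinner, ← Finset.sum_mul, hone]
    ring

/-! ## Sanity checks on the vocabulary (kernel-decided) -/

example : Pos.adm Pos.A 7 3 5 5 = true := by decide
example : Pos.adm Pos.A 7 3 5 4 = false := by decide
example : Pos.adm Pos.B 7 3 5 3 = true := by decide
example : Pos.adm Pos.C 7 3 4 2 = true := by decide
example : Pos.adm Pos.C 7 0 4 2 = false := by decide
example : mkDatum (Pos.exps Pos.B 4) 1 2 3 = (0, 4, 0, 1, 2, 3) := by decide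

end Summit.ABC.ABC.Theorems.TameLocalReceptacle

end
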